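import Literature.AlgebraicGeometry.Frobenioids.UnitEquivalenceProofs
import HarnessLib

/-!
# Frobenioids I, §3: proofs of the category-theoreticity facts — Proposition 3.3 (v)

Mochizuki, *The geometry of Frobenioids I: the general theory*, Kyushu J. Math. **62** (2008),
Prop. 3.3 (v), statement kurims p. 60, proof p. 61 [cite: MochizukiFrdI2008, Prop. 3.3 (v) p.60]:
the functor `C → F_Φ` is an equivalence of categories iff the Frobenioid `C` is of `Aut`-ample,
unit-trivial and base-trivial type.

PROOF-ONLY companion of `CategoryTheoreticityFacts.lean` / `BaseCategoryTheoreticityDefs.lean` (seat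
abc-iut-L1-t3; statements untouched): discharges the named fact `FrdI.Prop33v` — typed there with
"equivalence" unfolded as (an arrow is determined by `(Base, Div, deg_Fr)`) ∧ (every triple
`(f, Z, n)` is realised) ∧ (every object of `D` is isomorphic to some `Base A`) — as
`FrdI.Prop33v_holds`. Necessity (p. 61, "from Prop. 1.5 (i), (ii)"): units, lifts of base
automorphisms and of base isomorphisms are pinned down by their invariants. Sufficiency (p. 61):
`C` is of isotropic type (isotropic hulls are base-isomorphisms, Def. 1.3 (vii)(a)); faithfulness is
Prop. 3.3 (ii) with trivial units (`FrdI.exists_unit_of_invariants_eq`); for fullness an arrow with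
prescribed `(f, Z, n)` is assembled from a Frobenius-type endomorphism of degree `n` (Def. 1.3 (ii)),
a base-identity pre-step endomorphism with zero divisor `Z` (Def. 1.3 (iii)(d)) and a pull-back
morphism over `f` (Def. 1.3 (i)(c)), each corrected to the identity on the base by base-triviality
and `Aut`-ampleness; essential surjectivity is Def. 1.3 (i)(a). No statement is restated or
strengthened.
-/

-- `u.hom` for `u : Aut A` and `(baseFunctor F).mapIso` only unfold at default transparency.
set_option backward.isDefEq.respectTransparency false

namespace Literature.AlgebraicGeometry.Frobenioids

open CategoryTheory Opposite

universe w v v' u u'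

namespace FrdI

section OneFrobenioid

variable {D : Type u} [Category.{v} D] {Φ : Dᵒᵖ ⥤ CommMonCat.{w}} {C : Type u'} [Category.{v'} C]
  {F : C ⥤ ElemFrobenioid Φ}

/-- `Aut`-ampleness, unpacked: every automorphism of `Base(A)` is `Base(α)` for an automorphism
`α` of `A`. [cite: MochizukiFrdI2008, Def. 1.2 (iv) p.23] -/
theorem exists_aut_base_eq {A : C} (hA : (PreFrobenioidData.ofFunctor Φ F).IsAutAmple A)
    (b : PreFrobenioid.baseObj F A ⟶ PreFrobenioid.baseObj F A) [IsIso b] :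
    ∃ α : A ≅ A, PreFrobenioid.Base F α.hom = b := by
  obtain ⟨α, hα⟩ := hA (asIso b)
  exact ⟨α, (congrArg Iso.hom hα).trans (asIso_hom b)⟩

/-- Base-triviality, unpacked: a base-isomorphism `A → B` forces `A ≅ B`.
[cite: MochizukiFrdI2008, Def. 1.2 (iv) p.23] -/
theorem nonempty_iso_of_isBaseIso {A : C} (hA : (PreFrobenioidData.ofFunctor Φ F).IsBaseTrivial A) {B : C}
    (φ : A ⟶ B) (hφ : PreFrobenioid.IsBaseIso F φ) : Nonempty (A ≅ B) := by
  haveI : IsIso (PreFrobenioid.Base F φ) := hφ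
  exact hA B ⟨asIso (PreFrobenioid.Base F φ)⟩

/-- In a Frobenioid of unit-trivial… no: of base-trivial type every object is isotropic, since an
isotropic hull is a base-isomorphism (FrdI p. 61: "[by the existence of isotropic hulls in `C` — cf.
Definition 1.3, (vii), (a)] it follows that `C` is also of isotropic type").
[cite: MochizukiFrdI2008, Prop. 3.3 (v) p.61] -/
theorem isIsotropic_of_isBaseTrivial (hF : PreFrobenioid.IsFrobenioid F) {A : C}
    (hA : (PreFrobenioidData.ofFunctor Φ F).IsBaseTrivial A) : PreFrobenioid.IsIsotropic F A := by
  obtain ⟨A', h, hh⟩ := hF.vii_a A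
  obtain ⟨-, hp, hA', -⟩ := id hh
  obtain ⟨j⟩ := nonempty_iso_of_isBaseIso hA h hp.2
  intro B ψ hψi hψp
  haveI : IsIso (j.inv ≫ ψ) :=
    hA' (j.inv ≫ ψ) (PreFrobenioid.IsIsometry.comp F (PreFrobenioid.isIsometry_of_isIso F hF.isPreFrobenioid j.inv) hψi)
      (PreFrobenioid.IsPreStep.comp F (PreFrobenioid.isPreStep_of_isIso F j.inv) hψp)
  exact IsIso.of_isIso_comp_left j.inv ψ

/-- Correcting the base of a base-isomorphism `A → B` to the identity, in a Frobenioid of base-trivial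
and `Aut`-ample type: there is an isomorphism `j : B ≅ A` with `Base(φ ≫ j) = id`.
[cite: MochizukiFrdI2008, Prop. 3.3 (v) p.61] -/
theorem exists_iso_base_comp_eq_id {A : C} (hAut : (PreFrobenioidData.ofFunctor Φ F).IsAutAmple A)
    (hBase : (PreFrobenioidData.ofFunctor Φ F).IsBaseTrivial A) {B : C} (φ : A ⟶ B)
    (hφ : PreFrobenioid.IsBaseIso F φ) :
    ∃ j : B ≅ A, PreFrobenioid.Base F (φ ≫ j.hom) = 𝟙 _ := by
  haveI : IsIso (PreFrobenioid.Base F φ) := hφ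
  obtain ⟨k⟩ := nonempty_iso_of_isBaseIso hBase φ hφ
  haveI : IsIso (PreFrobenioid.Base F k.inv) := PreFrobenioid.isBaseIso_of_isIso F k.inv
  haveI : IsIso (PreFrobenioid.Base F (φ ≫ k.inv)) := by
    rw [PreFrobenioid.base_comp]
    infer_instance
  obtain ⟨α, hα⟩ := exists_aut_base_eq hAut (inv (PreFrobenioid.Base F (φ ≫ k.inv)))
  refine ⟨k.symm ≪≫ α, ?_⟩
  rw [Iso.trans_hom, Iso.symm_hom, ← Category.assoc, PreFrobenioid.base_comp F (φ ≫ k.inv), hα,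
    IsIso.hom_inv_id]

/-- **Prop. 3.3 (v), fullness**: in a Frobenioid of `Aut`-ample and base-trivial type every triple
`(f : Base A → Base B, Z ∈ Φ(Base A), n)` is `(Base, Div, deg_Fr)` of some arrow `A → B`.
[cite: MochizukiFrdI2008, Prop. 3.3 (v) p.61] -/
theorem exists_hom_of_invariants (hF : PreFrobenioid.IsFrobenioid F)
    (hAut : ∀ A : C, (PreFrobenioidData.ofFunctor Φ F).IsAutAmple A)
    (hBase : ∀ A : C, (PreFrobenioidData.ofFunctor Φ F).IsBaseTrivial A) (A B : C)
    (f : PreFrobenioid.baseObj F A ⟶ PreFrobenioid.baseObj F B)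
    (Z : Φ.obj (op (PreFrobenioid.baseObj F A))) (n : ℕ+) :
    ∃ φ : A ⟶ B, PreFrobenioid.Base F φ = f ∧ PreFrobenioid.Div F φ = Z ∧
      PreFrobenioid.degFr F φ = n := by
  have hP := hF.isPreFrobenioid
  -- (a) a Frobenius-type endomorphism of degree `n` over the identity
  obtain ⟨A₁, γ, hγ, hγn⟩ := hF.ii_exists A n
  obtain ⟨j₁, hj₁⟩ := exists_iso_base_comp_eq_id (hAut A) (hBase A) γ hγ.2
  have hγ'd : PreFrobenioid.Div F (γ ≫ j₁.hom) = 1 := by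
    rw [PreFrobenioid.div_comp, PreFrobenioid.isIsometry_of_isIso F hP j₁.hom, map_one, one_mul,
      show PreFrobenioid.Div F γ = 1 from hγ.1.2, one_pow]
  have hγ'n : PreFrobenioid.degFr F (γ ≫ j₁.hom) = n := by
    rw [PreFrobenioid.degFr_comp, hγn,
      show PreFrobenioid.degFr F j₁.hom = 1 from PreFrobenioid.isLinear_of_isIso F j₁.hom, mul_one]
  -- (b) a base-identity pre-step endomorphism with zero divisor `Z`
  obtain ⟨B₂, ε, hε, hεZ⟩ := hF.iii_d_under_surj A Z
  obtain ⟨j₂, hj₂⟩ := exists_iso_base_comp_eq_id (hAut A) (hBase A) ε hε.2.2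
  have hε'd : PreFrobenioid.Div F (ε ≫ j₂.hom) = Z := by
    rw [PreFrobenioid.div_comp, PreFrobenioid.isIsometry_of_isIso F hP j₂.hom, map_one, one_mul,
      hεZ, show PreFrobenioid.degFr F j₂.hom = 1 from PreFrobenioid.isLinear_of_isIso F j₂.hom,
      PNat.one_coe, pow_one]
  have hε'n : PreFrobenioid.degFr F (ε ≫ j₂.hom) = 1 := by
    rw [PreFrobenioid.degFr_comp, show PreFrobenioid.degFr F ε = 1 from hε.2.1,
      show PreFrobenioid.degFr F j₂.hom = 1 from PreFrobenioid.isLinear_of_isIso F j₂.hom, mul_one]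
  -- (c) a pull-back morphism over `f`, moved to `A`
  obtain ⟨W, ψ, i, hψ, hψb⟩ := exists_isPullbackMorphism_over' hF B f
  have hψ' := hF.iv_b ψ hψ
  obtain ⟨k⟩ := (hBase A) W ⟨i.symm⟩
  haveI : IsIso (PreFrobenioid.Base F k.hom) := PreFrobenioid.isBaseIso_of_isIso F k.hom
  obtain ⟨α₃, hα₃⟩ := exists_aut_base_eq (hAut A) (inv (PreFrobenioid.Base F k.hom ≫ i.hom))
  have hψ''b : PreFrobenioid.Base F (α₃.hom ≫ k.hom ≫ ψ) = f := by
    rw [PreFrobenioid.base_comp, PreFrobenioid.base_comp, hα₃, hψb, ← Category.assoc (PreFrobenioid.Base F k.hom),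
      IsIso.inv_hom_id_assoc]
  have hψ''d : PreFrobenioid.Div F (α₃.hom ≫ k.hom ≫ ψ) = 1 := by
    rw [PreFrobenioid.div_comp, PreFrobenioid.div_comp, show PreFrobenioid.Div F ψ = 1 from hψ'.1.2,
      map_one, one_mul, PreFrobenioid.isIsometry_of_isIso F hP k.hom, one_pow, map_one, one_mul,
      PreFrobenioid.isIsometry_of_isIso F hP α₃.hom, one_pow]
  have hψ''n : PreFrobenioid.degFr F (α₃.hom ≫ k.hom ≫ ψ) = 1 := by
    rw [PreFrobenioid.degFr_comp, PreFrobenioid.degFr_comp,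
      show PreFrobenioid.degFr F ψ = 1 from hψ'.2,
      show PreFrobenioid.degFr F k.hom = 1 from PreFrobenioid.isLinear_of_isIso F k.hom,
      show PreFrobenioid.degFr F α₃.hom = 1 from PreFrobenioid.isLinear_of_isIso F α₃.hom,
      mul_one, mul_one]
  -- (d) assemble
  refine ⟨(γ ≫ j₁.hom) ≫ (ε ≫ j₂.hom) ≫ (α₃.hom ≫ k.hom ≫ ψ), ?_, ?_, ?_⟩
  · rw [PreFrobenioid.base_comp, PreFrobenioid.base_comp (F := F) (ε ≫ j₂.hom), hj₁, hj₂, hψ''b,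
      Category.id_comp, Category.id_comp]
  · rw [PreFrobenioid.div_comp, PreFrobenioid.div_comp (F := F) (ε ≫ j₂.hom), hj₁, hj₂, pull_id,
      pull_id, hψ''d, one_mul, hε'd, hψ''n, PNat.one_coe, pow_one, hγ'd, one_pow, mul_one]
  · rw [PreFrobenioid.degFr_comp, PreFrobenioid.degFr_comp (F := F) (ε ≫ j₂.hom), hγ'n, hε'n, hψ''n,
      mul_one, mul_one]

/-- **Prop. 3.3 (v), faithfulness on invariants** in a Frobenioid of unit-trivial and base-trivial
type (Prop. 3.3 (ii) with trivial units; every object is isotropic).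
[cite: MochizukiFrdI2008, Prop. 3.3 (v) p.61] -/
theorem eq_of_invariants_eq (hF : PreFrobenioid.IsFrobenioid F)
    (hUnit : ∀ A : C, PreFrobenioid.unitsSubgroup F A = ⊥)
    (hBase : ∀ A : C, (PreFrobenioidData.ofFunctor Φ F).IsBaseTrivial A) {A B : C} (φ ψ : A ⟶ B)
    (hb : PreFrobenioid.Base F φ = PreFrobenioid.Base F ψ)
    (hd : PreFrobenioid.Div F φ = PreFrobenioid.Div F ψ)
    (hn : PreFrobenioid.degFr F φ = PreFrobenioid.degFr F ψ) : φ = ψ := by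
  obtain ⟨Y, γ, δ, u, hu, h₁, h₂⟩ :=
    exists_unit_of_invariants_eq hF (isIsotropic_of_isBaseTrivial hF (hBase A)) φ ψ hn hd hb
  have hu1 : u = 1 := by
    rw [hUnit Y] at hu
    exact hu
  rw [h₁, h₂, hu1]
  change γ ≫ δ = γ ≫ 𝟙 Y ≫ δ
  rw [Category.id_comp]

/-- **Prop. 3.3 (v), necessity**: if arrows are determined by `(Base, Div, deg_Fr)` and every triple is
realised, then `C` is of `Aut`-ample, unit-trivial and base-trivial type (FrdI p. 61).
[cite: MochizukiFrdI2008, Prop. 3.3 (v) p.61] -/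
theorem types_of_faithful_full (hP : IsPreFrobenioid Φ F)
    (hfaith : ∀ ⦃A B : C⦄ (φ ψ : A ⟶ B), PreFrobenioid.Base F φ = PreFrobenioid.Base F ψ →
      PreFrobenioid.Div F φ = PreFrobenioid.Div F ψ → PreFrobenioid.degFr F φ = PreFrobenioid.degFr F ψ →
      φ = ψ)
    (hfull : ∀ (A B : C) (f : PreFrobenioid.baseObj F A ⟶ PreFrobenioid.baseObj F B)
      (Z : Φ.obj (op (PreFrobenioid.baseObj F A))) (n : ℕ+),
      ∃ φ : A ⟶ B, PreFrobenioid.Base F φ = f ∧ PreFrobenioid.Div F φ = Z ∧ PreFrobenioid.degFr F φ = n) :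
    (∀ A : C, (PreFrobenioidData.ofFunctor Φ F).IsAutAmple A) ∧
      (∀ A : C, PreFrobenioid.unitsSubgroup F A = ⊥) ∧
      (∀ A : C, (PreFrobenioidData.ofFunctor Φ F).IsBaseTrivial A) := by
  -- lifting a base isomorphism `Base A ≅ Base B` to an isomorphism `A ≅ B` with prescribed base
  have lift : ∀ {A B : C} (β : PreFrobenioid.baseObj F A ≅ PreFrobenioid.baseObj F B),
      ∃ α : A ≅ B, PreFrobenioid.Base F α.hom = β.hom := by
    intro A B β
    obtain ⟨φ, hφb, hφd, hφn⟩ := hfull A B β.hom 1 1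
    obtain ⟨ψ, hψb, hψd, hψn⟩ := hfull B A β.inv 1 1
    have h1 : φ ≫ ψ = 𝟙 A := hfaith _ _
      (by rw [PreFrobenioid.base_comp, hφb, hψb, β.hom_inv_id, PreFrobenioid.base_id])
      (by rw [PreFrobenioid.div_comp, hψd, map_one, hφd, one_pow, mul_one, PreFrobenioid.div_id])
      (by rw [PreFrobenioid.degFr_comp, hφn, hψn, mul_one, PreFrobenioid.degFr_id])
    have h2 : ψ ≫ φ = 𝟙 B := hfaith _ _
      (by rw [PreFrobenioid.base_comp, hφb, hψb, β.inv_hom_id, PreFrobenioid.base_id])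
      (by rw [PreFrobenioid.div_comp, hφd, map_one, hψd, one_pow, mul_one, PreFrobenioid.div_id])
      (by rw [PreFrobenioid.degFr_comp, hφn, hψn, mul_one, PreFrobenioid.degFr_id])
    exact ⟨⟨φ, ψ, h1, h2⟩, hφb⟩
  refine ⟨fun A β => ?_, fun A => ?_, fun A B hAB => ?_⟩
  · obtain ⟨α, hα⟩ := lift β
    exact ⟨α, Iso.ext hα⟩
  · refine (Subgroup.eq_bot_iff_forall _).2 fun u hu => ?_
    have hub : PreFrobenioid.Base F u.hom = 𝟙 _ := hu.1
    have hun : PreFrobenioid.degFr F u.hom = 1 := hu.2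
    have h : u.hom = 𝟙 A := hfaith _ _ (by rw [hub, PreFrobenioid.base_id])
      (by rw [PreFrobenioid.isIsometry_of_isIso F hP u.hom, PreFrobenioid.div_id])
      (by rw [hun, PreFrobenioid.degFr_id])
    exact Iso.ext h
  · obtain ⟨β⟩ := hAB
    obtain ⟨α, -⟩ := lift β
    exact ⟨α⟩

end OneFrobenioid

/-! ### The named fact, discharged -/

/-- **[FrdI] Proposition 3.3 (v) — DISCHARGED** (in the unfolded form typed by the statement file):
`C → F_Φ` is an equivalence — arrows determined by `(Base, Div, deg_Fr)`, every triple realised, every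
object of `D` isomorphic to some `Base A` — iff the Frobenioid `C` is of `Aut`-ample, unit-trivial and
base-trivial type (kurims p. 60, proof p. 61). [cite: MochizukiFrdI2008, Prop. 3.3 (v) p.60] -/
theorem Prop33v_holds : Prop33v.{w, v, v', u, u'} := by
  intro D _ Φ C _ F hF
  constructor
  · rintro ⟨hfaith, hfull, -⟩
    obtain ⟨hAut, hUnit, hBase⟩ := types_of_faithful_full (F := F) hF.isPreFrobenioid hfaith hfull
    exact ⟨⟨hAut⟩, ⟨fun A => hUnit A⟩, ⟨hBase⟩⟩
  · rintro ⟨hAut, hUnit, hBase⟩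
    have hUnit' : ∀ A : C, PreFrobenioid.unitsSubgroup F A = ⊥ := fun A => hUnit.obj A
    refine ⟨fun A B φ ψ hb hd hn => eq_of_invariants_eq hF hUnit' hBase.obj φ ψ hb hd hn,
      fun A B f Z n => exists_hom_of_invariants hF hAut.obj hBase.obj A B f Z n, fun X => ?_⟩
    obtain ⟨A, -, ⟨i⟩⟩ := hF.i_a X
    exact ⟨A, ⟨i⟩⟩

end FrdI

end Literature.AlgebraicGeometry.Frobenioids
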